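import Mathlib
import HarnessLib
import Summits.HubbardSuperconductivity.HubbardSuperconductivity.Theorems.KLProgrammeKLRegimeEngineV8DefsU7
import Summits.HubbardSuperconductivity.HubbardSuperconductivity.Theorems.KLProgrammeKLRegimeEngineScaleZeroValuesDefs
import Summits.HubbardSuperconductivity.HubbardSuperconductivity.Theorems.KLProgrammePerturbedFermiCurveExplicit

/-!
# Route `KLProgramme` — ENGINE child gen 8 (stmt-HubbardSuperconductivity-20437 `KLRegimeEngineV17F2`), stub (e) rows C1/C2 under «(Y′) keyed GRID»:
# the n-FREE SMALLNESS of the grid-keyed nested-leg packagings is INSIDE THE REGISTERED DOORS (cell gate-hubbard-kl, seat hubbard-kl-r2d-p1 g8)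

The GRID-keyed row-C1/C2 packagings `cutLeg_/spLeg_allScales_of_gridMoments_V17F2_geometric4` (`…EngineTwoLegCutLegGridData` p560490,
`…EngineTwoLegSpLegGridDataFour` p559934) carry ONE n-free smallness hypothesis `hsmall : Zs·U² + 4/3·Gfr₁·U² ≤ klCurveD` (the separated shell-tube
gradient of the comparison volume plus the frame's own gradient must stay below half the transversality constant).  With the budgets OF RECORD
(plan g19 (R59o)/(R59ac), literals (A)) `Zs := 2^11·e¹⁸·κ₀⁴·klE3Acum R` (`κ₀² = 2(7+1606732)`) this is a consequence of the two registered coupling doors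
`U ≤ klE3U₀all R` (…EngineV8DefsU7 §4; `klEngU₀10 ≤ klE3U₀all`) and `U ≤ klCurveU0 R` (…PerturbedFermiCurveExplicit; `klEngU₀3 ≤ klCurveU0`) — so the v2
(e) closer needs NO DefsU11 row for the nested legs:

* `one_le_klScaleZeroA0` (`klScaleZeroA0 = 14·√((1/2 + 12/klE0)·(… + 1 + …)) ≥ 14·√(1/2) ≥ 1`), `two_pow_40_le_klE3Acum` (`klE3Acum = 2^40·klE3A1 ≥ 2^40`);
* **`twoLeg_gridLegSmallness_of_doors`** — `0 ≤ Gfr₀`, `0 ≤ Gfr₁`, `0 < U ≤ klE3U₀all R`, `U ≤ klCurveU0 R` ⟹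
  `(2^11·e¹⁸·κ₀⁴·klE3Acum R)·U² + 4/3·R.Gfr 1·U² ≤ klCurveD`: the first summand is `≤ 1/(2·klE3Acum R) ≤ 2^{-41}` (first `min` term of `klE3U₀all`),
  the second `≤ klCurveKappa/18 ≤ 1/90` (`Gfr₁·U ≤ klCurveKappa/24`, `U ≤ 1`), and `klCurveD = cDtmin(−1.1,−0.1)/2 ≥ 33/200`.

Proofs only; no definitions; nothing about the model is asserted; nothing asserts superconductivity.
-/

noncomputable section

namespace Summit.HubbardSuperconductivity.HubbardSuperconductivity.Theorems.EngineV8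

set_option linter.dupNamespace false -- summit = problem name (single-conjunct summit), D-0017

open Real Summit.HubbardSuperconductivity.HubbardSuperconductivity.Theorems.KLRegimeSplit
open Summit.HubbardSuperconductivity.HubbardSuperconductivity.Theorems.PerturbedFermiCurve

/-- **`1 ≤ klScaleZeroA0`**: the scale-`0` decay constant is `14·√((1/2 + 12/klE0)·S)` with `S ≥ 1` (all its summands are nonnegative and one of them is `1`). -/
theorem one_le_klScaleZeroA0 : 1 ≤ klScaleZeroA0 := by
  unfold klScaleZeroA0
  have he : (0 : ℝ) < klE0 := by norm_num [klE0]
  have h1 : (1 : ℝ) / 2 ≤ 1 / 2 + 12 / klE0 := by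
    have h12 : (0 : ℝ) ≤ 12 / klE0 := by positivity
    linarith
  have h2 : (1 : ℝ) ≤ 2 / klE0 + 128 * Real.pi ^ 4 * (4 * (1110 : ℝ) + 6 * (32 / 3) + 2) ^ 2 / klE0 +
      2 * Real.pi ^ 5 * (4 * (1110 : ℝ) + 6 * (32 / 3) + 2) ^ 2 / klE0 ^ 2 + 1 +
      Real.pi ^ 4 * ((7 : ℝ) ^ 2 * (4 * (1110 : ℝ) + 6 * (32 / 3) + 2) * (2 / klE0) + 7 * (2 * (32 / 3) + 1)) ^ 2 / klE0 ^ 3 := by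
    have ha : 0 ≤ 2 / klE0 + 128 * Real.pi ^ 4 * (4 * (1110 : ℝ) + 6 * (32 / 3) + 2) ^ 2 / klE0 +
        2 * Real.pi ^ 5 * (4 * (1110 : ℝ) + 6 * (32 / 3) + 2) ^ 2 / klE0 ^ 2 := by positivity
    have hb : 0 ≤ Real.pi ^ 4 * ((7 : ℝ) ^ 2 * (4 * (1110 : ℝ) + 6 * (32 / 3) + 2) * (2 / klE0) + 7 * (2 * (32 / 3) + 1)) ^ 2 / klE0 ^ 3 := by
      positivity
    linarith
  have hx : (1 : ℝ) / 196 ≤ (1 / 2 + 12 / klE0) *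
      (2 / klE0 + 128 * Real.pi ^ 4 * (4 * (1110 : ℝ) + 6 * (32 / 3) + 2) ^ 2 / klE0 +
        2 * Real.pi ^ 5 * (4 * (1110 : ℝ) + 6 * (32 / 3) + 2) ^ 2 / klE0 ^ 2 + 1 +
        Real.pi ^ 4 * ((7 : ℝ) ^ 2 * (4 * (1110 : ℝ) + 6 * (32 / 3) + 2) * (2 / klE0) + 7 * (2 * (32 / 3) + 1)) ^ 2 / klE0 ^ 3) := by
    nlinarith
  have hs : (1 : ℝ) / 14 ≤ Real.sqrt ((1 / 2 + 12 / klE0) *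
      (2 / klE0 + 128 * Real.pi ^ 4 * (4 * (1110 : ℝ) + 6 * (32 / 3) + 2) ^ 2 / klE0 +
        2 * Real.pi ^ 5 * (4 * (1110 : ℝ) + 6 * (32 / 3) + 2) ^ 2 / klE0 ^ 2 + 1 +
        Real.pi ^ 4 * ((7 : ℝ) ^ 2 * (4 * (1110 : ℝ) + 6 * (32 / 3) + 2) * (2 / klE0) + 7 * (2 * (32 / 3) + 1)) ^ 2 / klE0 ^ 3)) := by
    rw [show (1 : ℝ) / 14 = Real.sqrt ((1 / 14) ^ 2) by rw [Real.sqrt_sq (by norm_num)]]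
    exact Real.sqrt_le_sqrt (by linarith)
  linarith

/-- **`2^40 ≤ klE3Acum R`** (`klE3Acum = 2^40·klE3A1`, `klE3A1 ≥ klScaleZeroA0 ≥ 1`). -/
theorem two_pow_40_le_klE3Acum (R : RenConsts) : (2 : ℝ) ^ 40 ≤ klE3Acum R := by
  have h := one_le_klScaleZeroA0.trans (klScaleZeroA0_le_klE3A1 R)
  unfold klE3Acum
  nlinarith

/-- **THE n-FREE SMALLNESS OF THE GRID-KEYED NESTED LEGS IS INSIDE THE REGISTERED DOORS**: for `0 ≤ Gfr₀`, `0 ≤ Gfr₁`, `0 < U ≤ klE3U₀all R` and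
`U ≤ klCurveU0 R`, `(2^11·e¹⁸·κ₀⁴·klE3Acum R)·U² + 4/3·R.Gfr 1·U² ≤ klCurveD` — the `hsmall` hypothesis of `cutLeg_/spLeg_allScales_of_gridMoments_V17F2_geometric4`
at the budgets of record `Zs = 2^11·e¹⁸·κ₀⁴·klE3Acum R`. -/
theorem twoLeg_gridLegSmallness_of_doors {R : RenConsts} (hG0 : 0 ≤ R.Gfr 0) (hG1 : 0 ≤ R.Gfr 1) {U : ℝ} (hU : 0 < U)
    (hUall : U ≤ klE3U₀all R) (hUc : U ≤ klCurveU0 R) :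
    (2 : ℝ) ^ 11 * Real.exp 1 ^ 18 * Real.sqrt (2 * (7 + 1606732)) ^ 4 * klE3Acum R * U ^ 2 + 4 / 3 * R.Gfr 1 * U ^ 2 ≤ klCurveD := by
  have hA40 := two_pow_40_le_klE3Acum R
  have hA : 0 < klE3Acum R := klE3Acum_pos R
  have hκ : (0 : ℝ) < Real.sqrt (2 * (7 + 1606732)) := Real.sqrt_pos.2 (by norm_num)
  have he : (0 : ℝ) < Real.exp 1 := Real.exp_pos 1
  -- the first door: `U ≤ 1/(64·e⁹·κ₀²·klE3Acum)`
  set c : ℝ := 64 * Real.exp 1 ^ 9 * Real.sqrt (2 * (7 + 1606732)) ^ 2 with hc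
  have hc0 : 0 < c := by rw [hc]; positivity
  have hU1 : U ≤ 1 / (c * klE3Acum R) := by
    refine hUall.trans ?_
    unfold klE3U₀all
    rw [hc]
    exact (min_le_left _ _).trans (le_of_eq (by ring))
  have hcAU : c * klE3Acum R * U ≤ 1 := by
    have := mul_le_mul_of_nonneg_left hU1 (le_of_lt (mul_pos hc0 hA))
    rwa [mul_one_div_cancel (ne_of_gt (mul_pos hc0 hA))] at this
  have hcU : c * U ≤ 1 / klE3Acum R := by
    rw [le_div_iff₀ hA]
    calc c * U * klE3Acum R = c * klE3Acum R * U := by ring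
      _ ≤ 1 := hcAU
  -- first summand: `(c²/2)·A·U² = (cAU)·(cU)/2 ≤ (1/A)/2 ≤ 2^{-41}`
  have hfirst : (2 : ℝ) ^ 11 * Real.exp 1 ^ 18 * Real.sqrt (2 * (7 + 1606732)) ^ 4 * klE3Acum R * U ^ 2 ≤ 1 / 64 := by
    have hid : (2 : ℝ) ^ 11 * Real.exp 1 ^ 18 * Real.sqrt (2 * (7 + 1606732)) ^ 4 * klE3Acum R * U ^ 2 =
        (c * klE3Acum R * U) * (c * U) / 2 := by rw [hc]; ring
    rw [hid]
    have h1 : (c * klE3Acum R * U) * (c * U) ≤ 1 * (1 / klE3Acum R) :=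
      mul_le_mul hcAU hcU (by positivity) zero_le_one
    have h2 : 1 / klE3Acum R ≤ 1 / (2 : ℝ) ^ 40 := one_div_le_one_div_of_le (by positivity) hA40
    have h3 : (1 : ℝ) / 2 ^ 40 ≤ 1 / 32 := by norm_num
    linarith
  -- the second door: `Gfr₁·U ≤ klCurveKappa/24 ≤ 1/120`, and `U ≤ 1`
  have hUone : U ≤ 1 := hUc.trans (klCurveU0_le_one R)
  have hκ5 : klCurveKappa ≤ 1 / 5 := min_le_right _ _
  have hGU : R.Gfr 1 * U ≤ 1 / 120 := by
    have hden : 0 < 24 * (R.Gfr 0 + R.Gfr 1 + 1) := by positivity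
    have hU2 : U ≤ klCurveKappa / (24 * (R.Gfr 0 + R.Gfr 1 + 1)) := hUc.trans (min_le_right _ _)
    have h1 : U * (24 * (R.Gfr 0 + R.Gfr 1 + 1)) ≤ klCurveKappa := (le_div_iff₀ hden).1 hU2
    nlinarith [mul_nonneg hG0 hU.le, hU.le]
  have hsecond : 4 / 3 * R.Gfr 1 * U ^ 2 ≤ 1 / 90 := by
    have h1 : R.Gfr 1 * U ^ 2 ≤ R.Gfr 1 * U := by
      have : U ^ 2 ≤ U := by nlinarith
      exact mul_le_mul_of_nonneg_left this hG1
    nlinarith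
  -- the target: `klCurveD = cDtmin(−1.1,−0.1)/2 ≥ 33/200`
  have hD : (33 : ℝ) / 200 ≤ klCurveD := by unfold klCurveD; linarith [cDtmin_window_ge]
  linarith

end Summit.HubbardSuperconductivity.HubbardSuperconductivity.Theorems.EngineV8

end
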